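import Summits.HodgeConjecture.HodgeConjecture.Theorems.MarkmanPartnerTransportPicardThreeK3SquaresSquareOfGenerator
import Literature.AlgebraicGeometry.Surfaces.K3SymplecticAutomorphismRealMultiplication
import Literature.AlgebraicGeometry.HodgeTheory.ComplexGysinCorrespondence
import Literature.AlgebraicGeometry.HodgeTheory.ComplexGysinOrientation
import Literature.AlgebraicGeometry.HodgeTheory.GysinKernelProofs

/-!
# Route MarkmanPartnerTransport · crux `PicardThreeK3Squares` (stmt-HodgeConjecture-19652) —
# the known real-multiplication sub-sector: K3 surfaces with a symplectic automorphism of prime order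
# `p` and `End_Hdg(T(S)) ⊆ ℚ(√p)` (Varesco 2023, Thm. 2.1), modulo that named fact

Inside the real-multiplication ranks (`ρ(S) ∈ {4,6,7,8,10,12,13,14,16}`, `Theorems/…RealMultiplicationRanks`)
the one RM case in print besides the van Geemen–Schütt cycle-induced families is Varesco's Thm. 2.1
(Math. Z. 305 (2023)): on a projective K3 surface `S` with a symplectic automorphism `σ` of prime order
`p`, a Hodge similitude `ψ = √p` of `T(S)` (multiplier `p`, `ψ² = p`) is induced by an algebraic cycle on
`S × S` — the tree's named fact `Varesco2023_sqrtMultiplication_algebraic_of_symplecticAutomorphism`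
(reduced form; conclusion `IsAlgebraicCorrespondence 2 2 S S T ∧ T = ψ` on `transcendentalSubspace S`).
This file feeds it into the cycle-induced sector bookkeeping
(`CycleInducedSector.hodgeConjectureFor_square_of_cycleInducedSector`, p527234):

* `exists_corr_of_isAlgebraicCorrespondence` — bridge: an `IsAlgebraicCorrespondence 2 2 S S T`
  (`corrClassAction` for SOME pair of orientations) is `[γ]_* = pr₁_*(pr₂^*(–) ∪ γ)` for an algebraic
  `γ` and ANY orientation family `μ` (two orientations of the connected closed manifolds `S(ℂ)`,
  `(S ⊗ S)(ℂ)` differ by units, `gysinMap_eq_smul_of_fundamentalClass_eq`; rescale `γ`).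
* `exists_corr_transcendentalProjector` — the projector `Q = id - P_N` onto `T = (N¹)^⊥` along `N¹` is
  `[γ_Q]_*` for an algebraic `γ_Q` (diagonal minus `κ⁻¹ Σᵢ pr₁^* dᵢ ∪ pr₂^* dᵢ^∨`, Gram-dual divisor
  basis), kills `N¹` and is the identity on `T`.
* `hodgeConjectureFor_square_of_symplecticAutomorphism` — **HC for `S ⊗ S` for every projective K3
  surface with a symplectic automorphism of prime order `p` whose rational Hodge endomorphisms of `T(S)`
  lie in `ℚ + ℚψ`, `ψ` a Hodge similitude of multiplier `p` with `ψ² = p` (i.e. `End_Hdg(T(S)) ⊆ ℚ(√p)`),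
  MODULO Varesco's Thm. 2.1**: `g = a + b · T ∘ Q` is `N¹`-stable, cycle-induced (composition of
  algebraic correspondences, `corrComp_surfaces_of_cup` with the landed
  `SquareOfGenerator.cupProduct_mem_algebraicClasses_tripleProduct`) and agrees with `f = a + bψ` on `T`.
  With `p = 2`: Nikulin involutions and RM by `ℚ(√2)` (`…_of_isNikulinInvolution`).

No definition, no sorry; the named fact is a hypothesis. Prover seat hodge-nonav-19652-p1 (gen 0),
`--supports stmt-HodgeConjecture-19652`.

References: Varesco, Math. Z. 305 (2023) art. 69 = arXiv:2304.02519, §2 Thm. 2.1, Rem. 2.2, Thm. 2.9;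
van Geemen–Sarti, Math. Z. 255 (2007), §1.1; Fulton, *Young Tableaux*, App. B; Hatcher, Thm. 3.26.
-/

set_option linter.dupNamespace false

noncomputable section

namespace Summit.HodgeConjecture.HodgeConjecture.Theorems.MarkmanPartnerTransport.SymplecticLocus

open scoped Manifold
open Module CategoryTheory MonoidalCategory CartesianMonoidalCategory
open Literature.AlgebraicGeometry Literature.AlgebraicGeometry.Motives Literature.AlgebraicGeometry.HodgeTheory
open Literature.AlgebraicGeometry.Surfaces
open Literature.AlgebraicTopology.SingularHomology
open Summit.HodgeConjecture.HodgeConjecture.Theorems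
open Summit.HodgeConjecture.HodgeConjecture.Theorems.NikulinTwinTransport
open Summit.HodgeConjecture.HodgeConjecture.Theorems.NikulinTwinTransport.SquareGlueFree

variable {S : SchemeOver ℂ}

/-- `Corr[μ, hS ; γ, y] = pr₁_*(pr₂^* y ∪ γ)` on `H²(S(ℂ); ℂ)`. Local notation only. -/
local notation3 (prettyPrint := false) "Corr[" μ ", " hS " ; " γ ", " y "]" =>
  complexGysin μ (IsSmoothProjective.tensor_holds hS hS) hS
    (SemiCartesianMonoidalCategory.fst _ _) (rfl : 2 * 1 + 2 * 2 + 2 * 2 = 2 * 1 + 2 * (2 + 2))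
    (cupProduct (rfl : 2 * 1 + 2 * 2 = 2 * 1 + 2 * 2)
      (complexBetti.map (SemiCartesianMonoidalCategory.snd _ _) (2 * 1) y) γ)

/-! ### Bridge: `IsAlgebraicCorrespondence` in the `Corr[μ ; γ, –]` spelling -/

/-- **An algebraic self-correspondence of `H²` of a smooth projective surface is `[γ]_*` for an algebraic
class `γ` and any orientation family `μ`.** `IsAlgebraicCorrespondence 2 2 S S T` says
`T = corrClassAction μ₀ ν₀ γ₀` for SOME orientations `μ₀` of `(S ⊗ S)(ℂ)` and `ν₀` of `S(ℂ)` (with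
Poincaré duality) and an algebraic `γ₀`; since these closed manifolds are connected, `μ₀`, `ν₀` differ
from `μ (S ⊗ S)`, `μ S` by units (`HomologicalOrientation.exists_unit_fundamentalClass_eq_smul`), so the
two Gysin maps differ by a non-zero scalar `c` (`gysinMap_eq_smul_of_fundamentalClass_eq`) and
`T = [c • γ₀]_*^μ`. [cite: FultonYoungTableaux1997, Appendix B §B.1 (5)] [cite: HatcherAT2002, §3.3 Thm. 3.26] -/
theorem exists_corr_of_isAlgebraicCorrespondence (μ : OrientationFamily) (hS : IsSmoothProjective 2 S)
    {T : complexBetti S (2 * 1) →ₗ[ℂ] complexBetti S (2 * 1)} (hT : IsAlgebraicCorrespondence 2 2 S S T) :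
    ∃ γ ∈ algebraicClasses (S ⊗ S) 2, ∀ y : complexBetti S (2 * 1), T y = Corr[μ, hS ; γ, y] := by
  obtain ⟨μ₀, ν₀, hμ₀, hν₀, e, q, hab, hq, γ₀, hγ₀, hTeq⟩ := hT
  obtain rfl : e = 2 := by omega
  obtain rfl : q = 2 := by omega
  have hSS : IsSmoothProjective (2 + 2) (S ⊗ S) := IsSmoothProjective.tensor_holds hS hS
  -- the two pairs of orientations differ by units
  letI := hS.chartedSpace
  letI := hSS.chartedSpace
  haveI := Motives.ComplexPoints.compactSpace_of_isSmoothProjective hS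
  haveI := Motives.ComplexPoints.t2Space_of_isSmoothProjective hS
  haveI := connectedSpace_complexPoints hS
  haveI := Motives.ComplexPoints.compactSpace_of_isSmoothProjective hSS
  haveI := Motives.ComplexPoints.t2Space_of_isSmoothProjective hSS
  haveI := connectedSpace_complexPoints hSS
  obtain ⟨uY, huY, -⟩ := (μ hSS).exists_unit_fundamentalClass_eq_smul μ₀
  obtain ⟨uX, huX, -⟩ := (μ hS).exists_unit_fundamentalClass_eq_smul ν₀
  have key : gysinMap μ₀ ν₀ (Motives.AlgPoints.mapContinuous (L := ℂ) (fst S S))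
      (show 2 * 1 + 2 * 2 + 2 = 2 * (2 + 2) by omega) hq =
      (((uX : ℂ))⁻¹ * (uY : ℂ)) • gysinMap (μ hSS) (μ hS) (Motives.AlgPoints.mapContinuous (L := ℂ) (fst S S))
        (show 2 * 1 + 2 * 2 + 2 = 2 * (2 + 2) by omega) hq :=
    gysinMap_eq_smul_of_fundamentalClass_eq (OrientationFamily.hasPoincareDuality μ hS) hν₀ huY huX
      (by rw [← mul_assoc, mul_inv_cancel₀ (Units.ne_zero uX), one_mul]) _ _ _
  refine ⟨(((uX : ℂ))⁻¹ * (uY : ℂ)) • γ₀, Submodule.smul_mem _ _ hγ₀, fun y ↦ ?_⟩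
  rw [← LinearMap.congr_fun hTeq y, corrClassAction_apply, key, LinearMap.smul_apply,
    map_smul, map_smul,
    complexGysin_eq_gysinMap hSS hS (fst S S) (rfl : 2 * 1 + 2 * 2 + 2 * 2 = 2 * 1 + 2 * (2 + 2))
      (show 2 * 1 + 2 * 2 + 2 = 2 * (2 + 2) by omega) hq]

/-! ### The transcendental projector as an algebraic correspondence -/

/-- **The projector `Q` onto `T = (N¹)^⊥` along `N¹` is induced by an algebraic class**, for every smooth
projective surface `S` and orientation family `μ`: with a rational basis `dᵢ` of `N¹ = algebraicClasses S 1`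
and its Gram-dual basis `dᵢ^∨` (Hodge index: the cup form on `N¹` is non-degenerate,
`exists_neronSeveri_gramBasis`), `P y = Σᵢ (∫ y ∪ dᵢ^∨) dᵢ` is the identity on `N¹`, zero on `T`, and
`κ • P = [Σᵢ pr₁^* dᵢ ∪ pr₂^* dᵢ^∨]_*` (`corrFst_cross_of_cup_eq`); the diagonal acts as the identity; so
`Q := id - P = [Δ - κ⁻¹ Σᵢ pr₁^* dᵢ ∪ pr₂^* dᵢ^∨]_*` kills `N¹` and fixes `T` pointwise.
[cite: Varesco2023, §2 (p. 8)] [cite: KahnMurrePedrini2007, §7.2.2] [cite: Fulton1998, §16.1] -/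
theorem exists_corr_transcendentalProjector (μ : OrientationFamily) (hS : IsSmoothProjective 2 S) :
    ∃ (Q : complexBetti S (2 * 1) →ₗ[ℂ] complexBetti S (2 * 1)) (γ : complexBetti (S ⊗ S) (2 * 2)),
      γ ∈ algebraicClasses (S ⊗ S) 2 ∧ (∀ y, Q y = Corr[μ, hS ; γ, y]) ∧
      (∀ d ∈ algebraicClasses S 1, Q d = 0) ∧
      ∀ y : complexBetti S (2 * 1),
        (∀ d ∈ algebraicClasses S 1, cupProduct (rfl : 2 * 1 + 2 * 1 = 2 * 2) y d = 0) → Q y = y := by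
  classical
  have h4 : 2 * 1 + 2 * 1 = 2 * 2 := rfl
  set N : Submodule ℂ (complexBetti S (2 * 1)) := algebraicClasses S 1 with hNdef
  obtain ⟨r, d, M, hdQ, hdN, hdli, hspanN, hmulinv, hinvmul⟩ := exists_neronSeveri_gramBasis hS
  have hmemS : ∀ x ∈ N, x ∈ Submodule.span ℂ (Set.range d) := fun x hx ↦ by rw [hspanN]; exact hx
  set dv : Fin r → complexBetti S (2 * 1) := fun i ↦ ∑ j, ((M i j : ℚ) : ℂ) • d j with hdvdef
  have hdvN : ∀ i, dv i ∈ N := fun i ↦ Submodule.sum_mem _ fun j _ ↦ Submodule.smul_mem _ _ (hdN j)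
  have hsymm : ∀ x y : complexBetti S (2 * 1), cupProduct h4 x y = cupProduct h4 y x := fun x y ↦ by
    rw [cupProduct_gradedComm_holds ℂ _ h4 h4]
    norm_num
  have htdv : ∀ i k, traceC hS (cupProduct h4 (d k) (dv i)) = if i = k then 1 else 0 := by
    intro i k
    simp only [hdvdef, map_sum, map_smul, smul_eq_mul]
    rw [← hinvmul i k]
    refine Finset.sum_congr rfl fun j _ ↦ ?_
    rw [hsymm (d k) (d j)]
  -- `P y = Σᵢ (∫ y ∪ dᵢ^∨) dᵢ`
  let P : complexBetti S (2 * 1) →ₗ[ℂ] complexBetti S (2 * 1) :=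
    ∑ i, ((traceC hS) ∘ₗ ((cupProduct h4).flip (dv i))).smulRight (d i)
  have hP : ∀ y, P y = ∑ i, traceC hS (cupProduct h4 y (dv i)) • d i := fun y ↦ by
    simp only [P, LinearMap.sum_apply, LinearMap.smulRight_apply, LinearMap.comp_apply, LinearMap.flip_apply]
  have hPd : ∀ k, P (d k) = d k := fun k ↦ by
    rw [hP]
    simp_rw [htdv]
    simp [ite_smul, Finset.sum_ite_eq']
  have hPN : ∀ x ∈ N, P x = x := by
    intro x hx
    refine Submodule.span_induction (p := fun x _ ↦ P x = x) ?_ ?_ ?_ ?_ (hmemS x hx)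
    · rintro _ ⟨k, rfl⟩
      exact hPd k
    · rw [map_zero]
    · intro x y _ _ hx hy
      rw [map_add, hx, hy]
    · intro t x _ hx
      rw [map_smul, hx]
  have hPT : ∀ y, (∀ d ∈ N, cupProduct h4 y d = 0) → P y = 0 := fun y hy ↦ by
    rw [hP]
    exact Finset.sum_eq_zero fun i _ ↦ by rw [hy _ (hdvN i), map_zero, zero_smul]
  -- fibre integration and the class `Γ_P = Σᵢ pr₁^* dᵢ ∪ pr₂^* dᵢ^∨` acting as `κ P`
  obtain ⟨ω, hω⟩ := exists_traceC_eq_one hS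
  have hω0 : ω ≠ 0 := by
    rintro rfl
    rw [map_zero] at hω
    exact zero_ne_one hω
  obtain ⟨κ, hκ0, hκ⟩ := exists_fibreIntegral_fst μ hS hS (kunnethSpan_complexBetti hS hS (2 * (2 + 2)))
    hω0 (rfl : 2 * 2 + 2 * 2 = 0 + 2 * (2 + 2))
  set ΓP : complexBetti (S ⊗ S) (2 * 2) :=
    ∑ i, cupProduct h4 (complexBetti.map (fst S S) (2 * 1) (d i)) (complexBetti.map (snd S S) (2 * 1) (dv i))
    with hΓPdef
  have hΓPalg : ΓP ∈ algebraicClasses (S ⊗ S) 2 :=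
    Submodule.sum_mem _ fun i _ ↦
      cupProduct_fst_snd_mem_algebraicClasses_of_eq hS hS (hdN i) (hdvN i) (rfl : 1 + 1 = 2) h4
  have hΓPact : ∀ y, Corr[μ, hS ; ΓP, y] = κ • P y := by
    intro y
    rw [hP, Finset.smul_sum, hΓPdef, map_sum, map_sum]
    refine Finset.sum_congr rfl fun i _ ↦ ?_
    rw [corrFst_cross_of_cup_eq μ hS hS h4 (rfl : 2 * 1 + 2 * 2 = 2 * 1 + 2 * 2) h4
      (rfl : 2 * 1 + 2 * 2 + 2 * 2 = 2 * 1 + 2 * (2 + 2)) (rfl : 2 * 2 + 2 * 2 = 0 + 2 * (2 + 2)) hκ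
      (d i) (eq_traceC_smul hS hω (cupProduct h4 y (dv i))), smul_smul]
    congr 1
    rw [show ((-1 : ℂ) ^ (2 * 1 * (2 * 1))) = 1 by norm_num, one_mul, mul_comm]
  -- the diagonal
  set δ : complexBetti (S ⊗ S) (2 * 2) :=
    complexGysin μ hS (IsSmoothProjective.tensor_holds hS hS) (lift (𝟙 S) (𝟙 S))
      (rfl : 0 + 2 * (2 + 2) = 2 * 2 + 2 * 2) (singularCohomology.one ℂ (ComplexPoints S)) with hδdef
  have hδalg : δ ∈ algebraicClasses (S ⊗ S) 2 := diagonal_mem_algebraicClasses μ hS _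
  have hδact : ∀ y : complexBetti S (2 * 1), Corr[μ, hS ; δ, y] = y := fun y ↦
    corrFst_diagonal μ hS (rfl : 2 * 1 + 2 * 2 = 2 * 1 + 2 * 2)
      (rfl : 2 * 1 + 2 * 2 + 2 * 2 = 2 * 1 + 2 * (2 + 2)) (rfl : 0 + 2 * (2 + 2) = 2 * 2 + 2 * 2) y
  refine ⟨LinearMap.id - P, δ - κ⁻¹ • ΓP,
    Submodule.sub_mem _ hδalg (Submodule.smul_mem _ _ hΓPalg), fun y ↦ ?_, fun x hx ↦ ?_, fun y hy ↦ ?_⟩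
  · rw [map_sub, map_smul, map_sub, map_smul, hδact, hΓPact, smul_smul, inv_mul_cancel₀ hκ0, one_smul,
      LinearMap.sub_apply, LinearMap.id_apply]
  · rw [LinearMap.sub_apply, LinearMap.id_apply, hPN x hx, sub_self]
  · rw [LinearMap.sub_apply, LinearMap.id_apply, hPT y hy, sub_zero]

/-! ### The rung: HC for `S × S` on the `σ_p`-locus with `End_Hdg(T(S)) ⊆ ℚ(√p)` -/

/-- **The Hodge conjecture for `S ⊗ S` for a projective K3 surface `S` with a symplectic automorphism
of prime order `p` and `End_Hdg(T(S)) ⊆ ℚ(√p)`, modulo Varesco's Thm. 2.1.** Hypotheses: `σ` symplectic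
of prime order `p` (`IsSymplecticOfPrimeOrder`); `ψ` an endomorphism of `H²(S(ℂ); ℂ)` mapping
`T = transcendentalSubspace S` to itself, rational and type-preserving there, with `ψ² = p` and
multiplier `p` on `T` (a Hodge similitude `√p`, the hypotheses of the named fact verbatim); and the
sector clause "`End_Hdg(T(S)) ⊆ ℚ + ℚψ`": every rational Hodge endomorphism `f` killing `N¹` with
image `⊥ N¹` is `a + bψ` on `T` (`a, b ∈ ℚ`). Proof: Varesco's fact gives an algebraic correspondence `T₀`
with `T₀ = ψ` on `T`; `exists_corr_of_isAlgebraicCorrespondence` writes `T₀ = [γ]_*`; with the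
transcendental projector `Q = [γ_Q]_*` (`exists_corr_transcendentalProjector`), `g = a + b · T₀ ∘ Q` is
`N¹`-stable, cycle-induced (`corrComp_surfaces_of_cup`, diagonal) and equals `f` on `T`; conclude by
`CycleInducedSector.hodgeConjectureFor_square_of_cycleInducedSector`. Covers the printed case "RM by
`ℚ(√p)` on the Nikulin / `σ_p` locus" of the crux `PicardThreeK3Squares` inside the real-multiplication
ranks. [cite: Varesco2023, §2 Thm. 2.1, Rem. 2.2 and p. 8] [cite: Fulton1998, §16.1 Prop. 16.1.1] -/
theorem hodgeConjectureFor_square_of_symplecticAutomorphism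
    (hV : Varesco2023_sqrtMultiplication_algebraic_of_symplecticAutomorphism) (hS : IsK3Surface S)
    (σ : S ⟶ S) (p : ℕ) (hσ : IsSymplecticOfPrimeOrder S σ p)
    (ψ : complexBetti S (2 * 1) →ₗ[ℂ] complexBetti S (2 * 1))
    (hψT : Set.MapsTo ψ (transcendentalSubspace S) (transcendentalSubspace S))
    (hψrat : ∀ x ∈ transcendentalSubspace S, IsRationalClass x → IsRationalClass (ψ x))
    (hψtyp : ∀ (i j : ℕ), ∀ x ∈ transcendentalSubspace S,
      IsOfHodgeType 2 S (2 * 1) i j x → IsOfHodgeType 2 S (2 * 1) i j (ψ x))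
    (hψsq : ∀ x ∈ transcendentalSubspace S, ψ (ψ x) = (p : ℂ) • x)
    (hψmul : ∀ x ∈ transcendentalSubspace S, ∀ y ∈ transcendentalSubspace S,
      cupProduct (rfl : 2 * 1 + 2 * 1 = 2 * 2) (ψ x) (ψ y) =
        (p : ℂ) • cupProduct (rfl : 2 * 1 + 2 * 1 = 2 * 2) x y)
    (hU : ∀ (f : complexBetti S (2 * 1) →ₗ[ℂ] complexBetti S (2 * 1)),
      (∀ y, IsRationalClass y → IsRationalClass (f y)) →
      (∀ (i j : ℕ) y, IsOfHodgeType 2 S (2 * 1) i j y → IsOfHodgeType 2 S (2 * 1) i j (f y)) →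
      (∀ d ∈ algebraicClasses S 1, f d = 0) →
      (∀ y : complexBetti S (2 * 1), ∀ d ∈ algebraicClasses S 1,
        cupProduct (rfl : 2 * 1 + 2 * 1 = 2 * 2) (f y) d = 0) →
      ∃ a b : ℚ, ∀ y : complexBetti S (2 * 1),
        (∀ d ∈ algebraicClasses S 1, cupProduct (rfl : 2 * 1 + 2 * 1 = 2 * 2) y d = 0) →
        f y = (a : ℂ) • y + (b : ℂ) • ψ y) :
    HodgeConjectureFor 4 (S ⊗ S) := by
  have h4 : 2 * 1 + 2 * 1 = 2 * 2 := rfl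
  set μ : OrientationFamily := complexOrientationFamily with hμdef
  -- Varesco: `ψ` is an algebraic correspondence on `T`; bridge to the `Corr` spelling
  obtain ⟨T₀, hT₀alg, hT₀ψ⟩ := hV hS σ p hσ ψ hψT hψrat hψtyp hψsq hψmul
  obtain ⟨γ, hγalg, hγ⟩ := exists_corr_of_isAlgebraicCorrespondence μ hS.isSmoothProjective hT₀alg
  obtain ⟨Q, γQ, hγQalg, hQ, hQN, hQT⟩ := exists_corr_transcendentalProjector μ hS.isSmoothProjective
  -- `T₀ ∘ Q` is cycle-induced
  obtain ⟨γ₂, hγ₂alg, hγ₂⟩ := corrComp_surfaces_of_cup μ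
    SquareOfGenerator.cupProduct_mem_algebraicClasses_tripleProduct S S S hS.isSmoothProjective
    hS.isSmoothProjective hS.isSmoothProjective γ hγalg γQ hγQalg
  -- the diagonal
  set δ : complexBetti (S ⊗ S) (2 * 2) :=
    complexGysin μ hS.isSmoothProjective (IsSmoothProjective.tensor_holds hS.isSmoothProjective hS.isSmoothProjective)
      (lift (𝟙 S) (𝟙 S)) (rfl : 0 + 2 * (2 + 2) = 2 * 2 + 2 * 2) (singularCohomology.one ℂ (ComplexPoints S))
    with hδdef
  have hδalg : δ ∈ algebraicClasses (S ⊗ S) 2 := diagonal_mem_algebraicClasses μ hS.isSmoothProjective _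
  have hδact : ∀ y : complexBetti S (2 * 1), Corr[μ, hS.isSmoothProjective ; δ, y] = y := fun y ↦
    corrFst_diagonal μ hS.isSmoothProjective (rfl : 2 * 1 + 2 * 2 = 2 * 1 + 2 * 2)
      (rfl : 2 * 1 + 2 * 2 + 2 * 2 = 2 * 1 + 2 * (2 + 2)) (rfl : 0 + 2 * (2 + 2) = 2 * 2 + 2 * 2) y
  -- `y ⊥ N¹` lies in `transcendentalSubspace S`
  have hmemT : ∀ y : complexBetti S (2 * 1),
      (∀ d ∈ algebraicClasses S 1, cupProduct h4 y d = 0) → y ∈ transcendentalSubspace S := by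
    intro y hy
    rw [mem_transcendentalSubspace_iff]
    intro c hc
    rw [cupProduct_gradedComm_holds ℂ _ h4 h4, hy c hc.2, smul_zero]
  refine CycleInducedSector.hodgeConjectureFor_square_of_cycleInducedSector μ hS.isSmoothProjective
    fun f hf₁ hf₂ hf₃ hf₄ ↦ ?_
  obtain ⟨a, b, hab⟩ := hU f hf₁ hf₂ hf₃ hf₄
  refine ⟨(a : ℂ) • LinearMap.id + (b : ℂ) • (T₀ ∘ₗ Q), fun d hd ↦ ?_,
    ⟨(a : ℂ) • δ + (b : ℂ) • γ₂, Submodule.add_mem _ (Submodule.smul_mem _ _ hδalg)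
      (Submodule.smul_mem _ _ hγ₂alg), fun y ↦ ?_⟩, fun y hy ↦ ?_⟩
  · -- `N¹`-stability: `Q d = 0`
    rw [LinearMap.add_apply, LinearMap.smul_apply, LinearMap.smul_apply, LinearMap.id_apply,
      LinearMap.comp_apply, hQN d hd, map_zero, smul_zero, add_zero]
    exact Submodule.smul_mem _ _ hd
  · -- the class
    rw [LinearMap.add_apply, LinearMap.smul_apply, LinearMap.smul_apply, LinearMap.id_apply,
      LinearMap.comp_apply, map_add, map_smul, map_smul, map_add, map_smul, map_smul, hδact, hγ₂ y, ← hQ y,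
      ← hγ (Q y)]
  · -- agreement on `T`
    rw [hab y hy, LinearMap.add_apply, LinearMap.smul_apply, LinearMap.smul_apply, LinearMap.id_apply,
      LinearMap.comp_apply, hQT y hy, hT₀ψ y (hmemT y hy)]

/-- **Nikulin spelling (`p = 2`): HC for `S ⊗ S` for a projective K3 surface with a Nikulin involution
and `End_Hdg(T(S)) ⊆ ℚ(√2)`, modulo Varesco's Thm. 2.1** (dictionary
`isNikulinInvolution_iff_isSymplecticOfPrimeOrder_two`). [cite: Varesco2023, Thm. 2.1 and Thm. 2.9]
[cite: VanGeemenSarti2007, §1.1] -/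
theorem hodgeConjectureFor_square_of_isNikulinInvolution
    (hV : Varesco2023_sqrtMultiplication_algebraic_of_symplecticAutomorphism) (hS : IsK3Surface S)
    {ι : S ⟶ S} (hι : IsNikulinInvolution S ι)
    (ψ : complexBetti S (2 * 1) →ₗ[ℂ] complexBetti S (2 * 1))
    (hψT : Set.MapsTo ψ (transcendentalSubspace S) (transcendentalSubspace S))
    (hψrat : ∀ x ∈ transcendentalSubspace S, IsRationalClass x → IsRationalClass (ψ x))
    (hψtyp : ∀ (i j : ℕ), ∀ x ∈ transcendentalSubspace S,
      IsOfHodgeType 2 S (2 * 1) i j x → IsOfHodgeType 2 S (2 * 1) i j (ψ x))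
    (hψsq : ∀ x ∈ transcendentalSubspace S, ψ (ψ x) = (2 : ℂ) • x)
    (hψmul : ∀ x ∈ transcendentalSubspace S, ∀ y ∈ transcendentalSubspace S,
      cupProduct (rfl : 2 * 1 + 2 * 1 = 2 * 2) (ψ x) (ψ y) =
        (2 : ℂ) • cupProduct (rfl : 2 * 1 + 2 * 1 = 2 * 2) x y)
    (hU : ∀ (f : complexBetti S (2 * 1) →ₗ[ℂ] complexBetti S (2 * 1)),
      (∀ y, IsRationalClass y → IsRationalClass (f y)) →
      (∀ (i j : ℕ) y, IsOfHodgeType 2 S (2 * 1) i j y → IsOfHodgeType 2 S (2 * 1) i j (f y)) →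
      (∀ d ∈ algebraicClasses S 1, f d = 0) →
      (∀ y : complexBetti S (2 * 1), ∀ d ∈ algebraicClasses S 1,
        cupProduct (rfl : 2 * 1 + 2 * 1 = 2 * 2) (f y) d = 0) →
      ∃ a b : ℚ, ∀ y : complexBetti S (2 * 1),
        (∀ d ∈ algebraicClasses S 1, cupProduct (rfl : 2 * 1 + 2 * 1 = 2 * 2) y d = 0) →
        f y = (a : ℂ) • y + (b : ℂ) • ψ y) :
    HodgeConjectureFor 4 (S ⊗ S) :=
  hodgeConjectureFor_square_of_symplecticAutomorphism hV hS ι 2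
    (isNikulinInvolution_iff_isSymplecticOfPrimeOrder_two.1 hι) ψ hψT hψrat hψtyp
    (by exact_mod_cast hψsq) (by exact_mod_cast hψmul) hU

end Summit.HodgeConjecture.HodgeConjecture.Theorems.MarkmanPartnerTransport.SymplecticLocus

end
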